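import Literature.NumberTheory.EllipticCurves.Sprung2012.ColemanMapJointLinearProofs
import Literature.NumberTheory.EllipticCurves.Sprung2012.HondaOrbitCongruenceProofs
import HarnessLib

/-!
# Sprung 2012 Thm. 2.2 / Lemma 2.3: the cokernel `Λ/(T)` of the joint Coleman map `(Col♯, Col♭)` modulo the RANK clause
# of the level-`2` Honda span — (IND) discharged from RANK (proofs only; part 2 of 2)

Topic `Literature/NumberTheory/EllipticCurves`, cluster `Sprung2012` (namespace = path). A THEOREMS file (no definition, no named
fact; net Literature debt `0`). Cell `bsd-ssimc`, width seat `cruxlead-stmt-BirchSwinnertonDyer-19875-w2` (gen 8), `--supports`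
stmt-BirchSwinnertonDyer-22569 (item (α) of the F-α discharge list of the x8 cruxes `KatoFineLowerSporadicX8` / `CyclotomicLowerPosLevelX8`).
F. E. I. Sprung, *Iwasawa theory for elliptic curves at supersingular primes: A pair of main conjectures*, J. Number Theory **132**
(2012) [Sprung2012]. `ColemanMapJointCokernelProofs.lean` / `ColemanMapJointLinearProofs.lean` prove the exact sequence (SES-KP)
`0 → H¹_Iw(T) → Λ² → ℤ_p → 0` of the tree's functional model modulo the point-independence clause (IND); the abstract theorem
`dvd_and_dvd_of_honda_rank` (part 1, `HondaOrbitCongruenceProofs.lean`) derives (IND) from the RANK clause. THIS FILE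
instantiates it on the layer `E(K_2·K_v) = localLayerPointsOfEmb κ ι W 2` (the action of `g` as a `ℤ`-linear endomorphism;
`γ^{p²} c_2 = c_2`, `γ^p c_1 = c_1` by `pow_mul_smul_of_mem_localLayerPointsOfEmb`; the Honda relation through
`localTraceOfEmb_succ_eq_sum_pow_smul`; `y ∈ E(K_2·K_v)` by the `p`-saturation of layers in a `p`-torsion-free tower) and
restates the cokernel theorems with the RANK clause as the ONLY residual hypothesis:

* `honda_independent_of_rank` — (IND) from: no `p`-torsion in the tower, `c_{−1} ∉ p·E(K_2·K_v)`, and **(RANK) for every family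
  of `p² − 1` points of `E(K_2·K_v)` some functional `w : E(K_2·K_v) →+ ℤ_p` is `≡ 0 (mod p)` on the family and `≢ 0` at some
  orbit point `gʲc_2` or `gʲc_1`** (any base field / `ℤ_p`-extension / place);
* `forall_exists_isColemanPair_X_mul_of_rank` — `T·Λ² ⊆ Col(H¹_Iw(T))` from (RANK) (any base);
* `natCast_dvd_of_nsmul_eq_zsmul_cneg` — over `ℚ` at an odd supersingular prime `c_{−1} ∉ p·E(ℚ_{p,2})` is a THEOREM
  (`exists_addMonoidHom_not_dvd_apply_cneg`, the heart of Prop. 7.3);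
* `forall_exists_isColemanPair_X_mul_of_rank_rat`, `exists_linearMap_isColemanPair_cokernel_of_rank_rat` — over `ℚ`, `p ≠ 2`
  good supersingular: modulo (RANK) alone, every `(T·x, T·y)` is a Coleman value, and the joint Coleman map is an injective
  `Λ`-linear `J` with `ℓ_𝔭(Λ²/range J) = 0` at every prime `𝔭 ∌ T` — the hypotheses `J`/`hJ`/`hcoker` of the F-α skeleton
  `min_lengthAt_quotient_range_le_lengthAt_torsion_of_skeleton` (Summits).

HONEST FRAMING — the residual (RANK). It is the dual form of «the Honda orbit spans a `p²`-dimensional subspace of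
`E(ℚ_{p,2})/p`», TRUE for every Honda system of the predicate `IsHondaSystem` on an actual curve: the dual generation clauses
(inj₂)+(sat₂) make the `ℤ_p`-span of the orbit the formal-group part of `E(ℚ_{p,2})`, and `E(ℚ_{p,2}) ≅ ℤ_p^{p²} ⊕ (finite of order
prime to p)` as an abstract group (`Ê(𝔪)` torsion-free of finite index over `𝔪^r ≅ ℤ_p^{[ℚ_{p,2}:ℚ_p]}`: Silverman AEC IV.6.4 /
VII.6.3, Lutz; Sprung Lemma 2.3) — so every `𝔽_p`-functional on `E(ℚ_{p,2})/p` lifts to a `ℤ_p`-valued one. The RANK of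
`E(ℚ_{p,2}) ⊗ ℤ_p` is not in the tree (the dual clauses of `IsHondaSystem` give generation, never rank), so (RANK) is displayed.
Nothing about any Selmer group, main conjecture or BSD is asserted.

References: [Sprung2012] Thm. 2.2, Lemma 2.3 (p. 1487), Def. 3.1 (p. 1489), Def. 5.9 (p. 1495), Def. 7.1–7.2, Props. 7.3/7.6
(pp. 1500–1501), Lemma 7.10 (p. 1503); [KuriharaPollack2007] Prop. 1.2; [LeiSujatha2021] §3 (SES-KP); [Silverman2009] AEC IV.6.4,
VII.6.3; tree `Sprung2012/{ColemanMaps, LocalTowerTraceProofs, LocalTowerLayersProofs, LocalTowerNoPTorsionProofs,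
ColemanMapSurjectiveProofs, ColemanMapJointCokernelProofs, ColemanMapJointLinearProofs, HondaOrbitCongruenceProofs}.lean`.
-/

noncomputable section

open scoped Classical

open Polynomial Finset

namespace Literature.NumberTheory.EllipticCurves.Sprung2012

/-! ## §2 The tower: (IND) from the rank clause on the layer `E(K_2·K_v)` -/

section Local

universe u

variable {K : Type u} [Field K] {p : ℕ} [Fact p.Prime] (κ : ZpExtension K p)
variable {E : Type u} [Field E] [Algebra K E] (ι : AlgebraicClosure K →ₐ[K] AlgebraicClosure E)
variable (W : WeierstrassCurve K)

open Literature.NumberTheory.EllipticCurves Literature.NumberTheory.GaloisRepresentations ZpExtension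
  Literature.NumberTheory.EllipticCurves.Kobayashi2003 Literature.NumberTheory.EllipticCurves.Sprung2017

variable {κ ι W}

/-- **(IND) from (RANK) on the tower.** For a Honda system `(c_{−1}, c)` (`p ∣ a_p`, `g` a local lift of the topological
generator) on a tower `E(K_∞·K_v)` without `p`-torsion and with `c_{−1} ∉ p·E(K_2·K_v)`: IF no `p² − 1` points of the layer
`E(K_2·K_v)` contain the Honda orbit `{gʲc_2} ∪ {gʲc_1}` in their span modulo `p` — witnessed by functionals
`w : E(K_2·K_v) →+ ℤ_p` (the RANK clause: `Ê(𝔪_2)` free of rank `p²`, Sprung Thm. 2.2 / Lemma 2.3) — THEN `c_{−1}` and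
`q = ∑_{j<p²} C(j,p) gʲc_2 − 2∑_{j<p} j gʲc_1` are `𝔽_p`-independent in `E(K_∞·K_v)/p` (the clause (IND) of
`forall_exists_isColemanPair_X_mul_of_independent`). [cite: Sprung2012, Thm. 2.2 and Lemma 2.3 (p. 1487), Lemma 7.10 (p. 1503)] -/
theorem honda_independent_of_rank {ap : ℤ} (hap : (p : ℤ) ∣ ap) {g : Field.absoluteGaloisGroup E}
    (hg : κ.IsTopGenerator (resGalOfEmb ι g)) {cneg : localPoints W E} {c : ℕ → localPoints W E}
    (hH : IsHondaSystem κ ι W ap g cneg c)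
    (hN : ∀ P : localPoints W E, P ∈ localTowerPointsOfEmb κ ι W → p • P = 0 → P = 0)
    (hcneg : ∀ (m : ℤ) (y : localPoints W E), y ∈ localLayerPointsOfEmb κ ι W 2 → p • y = m • cneg → (p : ℤ) ∣ m)
    (hrank : ∀ x : Fin (p ^ 2 - 1) → localPoints W E, (∀ i, x i ∈ localLayerPointsOfEmb κ ι W 2) →
      ∃ w : localLayerPointsOfEmb κ ι W 2 →+ ℤ_[p],
        (∀ i, (p : ℤ_[p]) ∣ evalOn W (localLayerPointsOfEmb κ ι W 2) w (x i)) ∧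
        ((∃ j : ℕ, ¬ (p : ℤ_[p]) ∣ evalOn W (localLayerPointsOfEmb κ ι W 2) w (g ^ j • c 2)) ∨
          ∃ j : ℕ, ¬ (p : ℤ_[p]) ∣ evalOn W (localLayerPointsOfEmb κ ι W 2) w (g ^ j • c 1))) :
    ∀ (m₀ m₁ : ℤ) (y : localPoints W E), y ∈ localTowerPointsOfEmb κ ι W →
      p • y = m₀ • cneg + m₁ • (∑ j ∈ range (p ^ 2), (j.choose p) • (g ^ j • c 2) - 2 • ∑ j ∈ range p, j • (g ^ j • c 1)) →
      (p : ℤ) ∣ m₀ ∧ (p : ℤ) ∣ m₁ := by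
  intro m₀ m₁ y hy hpy
  have hp : p.Prime := Fact.out
  set L := localLayerPointsOfEmb κ ι W 2 with hL
  have hc2 : c 2 ∈ L := hH.2.1 2
  have hc1 : c 1 ∈ L := localLayerPointsOfEmb_mono κ ι W (by norm_num : 1 ≤ 2) (hH.2.1 1)
  have hcn : cneg ∈ L := localLayerPointsOfEmb_mono κ ι W (Nat.zero_le 2) hH.1
  have hgL : ∀ {x : localPoints W E}, x ∈ L → g • x ∈ L := fun hx ↦ smul_mem_localLayerPointsOfEmb κ ι W 2 g hx
  have hgjL : ∀ (j : ℕ) {x : localPoints W E}, x ∈ L → g ^ j • x ∈ L := fun j _ hx ↦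
    smul_mem_localLayerPointsOfEmb κ ι W 2 _ hx
  -- the endomorphism `γ = g` of the layer, as a `ℤ`-linear map
  let γ₀ : L →+ L :=
    { toFun := fun x ↦ ⟨g • (x : localPoints W E), hgL x.2⟩
      map_zero' := Subtype.ext (by simp)
      map_add' := fun a b ↦ Subtype.ext (by simp [smul_add]) }
  set γ : Module.End ℤ L := γ₀.toIntLinearMap with hγ
  have hγpow : ∀ (j : ℕ) (x : L), (((γ ^ j) x : L) : localPoints W E) = g ^ j • (x : localPoints W E) := by
    intro j
    induction j with
    | zero => intro x; rw [pow_zero, Module.End.one_apply, pow_zero, one_smul]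
    | succ j ih => intro x; rw [pow_succ, Module.End.mul_apply, ih, pow_succ, mul_smul]; rfl
  -- the right-hand side lies in the layer, hence so does `y`
  have hqL : (∑ j ∈ range (p ^ 2), (j.choose p) • (g ^ j • c 2) - 2 • ∑ j ∈ range p, j • (g ^ j • c 1)) ∈ L :=
    sub_mem (AddSubgroup.sum_mem _ fun j _ ↦ AddSubgroup.nsmul_mem _ (hgjL j hc2) _)
      (AddSubgroup.nsmul_mem _ (AddSubgroup.sum_mem _ fun j _ ↦ AddSubgroup.nsmul_mem _ (hgjL j hc1) _) _)
  have hyL : y ∈ L := by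
    refine mem_localLayerPointsOfEmb_of_pow_nsmul_mem κ ι W hN hy (k := 1) ?_
    rw [pow_one, hpy]
    exact add_mem (AddSubgroup.zsmul_mem _ hcn _) (AddSubgroup.zsmul_mem _ hqL _)
  -- apply the abstract theorem in the layer
  refine dvd_and_dvd_of_honda_rank (p := p) γ hap (C2 := ⟨c 2, hc2⟩) (C1 := ⟨c 1, hc1⟩) (Cneg := ⟨cneg, hcn⟩)
    ?_ ?_ ?_ ?_ ?_ m₀ m₁ ⟨y, hyL⟩ ?_
  · exact Subtype.ext (by rw [hγpow]; have := pow_mul_smul_of_mem_localLayerPointsOfEmb κ ι W hg hc2 1; rwa [mul_one] at this)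
  · exact Subtype.ext (by rw [hγpow]; have := pow_mul_smul_of_mem_localLayerPointsOfEmb κ ι W hg (hH.2.1 1) 1; rwa [pow_one, mul_one] at this)
  · apply Subtype.ext
    rw [AddSubmonoidClass.coe_finsetSum, AddSubgroupClass.coe_zsmul]
    simp_rw [hγpow]
    have htr := localTraceOfEmb_succ_eq_sum_pow_smul κ ι W hg 0 (hH.2.1 1)
    simp only [pow_zero, one_mul] at htr
    rw [← htr, hH.2.2.2.1, hH.2.2.1, smul_smul, ← sub_smul]
  · intro m y' h
    refine hcneg m y' y'.2 ?_
    have := congrArg (fun t : L ↦ (t : localPoints W E)) h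
    simpa only [AddSubgroupClass.coe_zsmul, AddSubmonoidClass.coe_nsmul, natCast_zsmul] using this
  · intro x
    obtain ⟨w, hwx, hw⟩ := hrank (fun i ↦ (x i : localPoints W E)) (fun i ↦ (x i).2)
    refine ⟨w, fun i ↦ ?_, ?_⟩
    · have h := hwx i
      rwa [evalOn_of_mem W _ w (x i).2, Subtype.coe_eta] at h
    · refine hw.imp (fun ⟨j, hj⟩ ↦ ⟨j, ?_⟩) (fun ⟨j, hj⟩ ↦ ⟨j, ?_⟩)
      · rwa [evalOn_of_mem W _ w (hgjL j hc2), show (⟨g ^ j • c 2, hgjL j hc2⟩ : L) = (γ ^ j) ⟨c 2, hc2⟩ from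
          Subtype.ext (by rw [hγpow])] at hj
      · rwa [evalOn_of_mem W _ w (hgjL j hc1), show (⟨g ^ j • c 1, hgjL j hc1⟩ : L) = (γ ^ j) ⟨c 1, hc1⟩ from
          Subtype.ext (by rw [hγpow])] at hj
  · apply Subtype.ext
    have e : (((p : ℤ) • (⟨y, hyL⟩ : L) : L) : localPoints W E) = p • y := by
      rw [AddSubgroupClass.coe_zsmul, natCast_zsmul]
    rw [e, hpy, AddMemClass.coe_add, AddSubgroupClass.coe_zsmul, AddSubgroupClass.coe_zsmul, AddSubgroupClass.coe_sub,
      AddSubmonoidClass.coe_finsetSum, AddSubmonoidClass.coe_nsmul, AddSubmonoidClass.coe_finsetSum]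
    simp_rw [AddSubgroupClass.coe_zsmul, hγpow, natCast_zsmul]

/-- **`T·Λ² ⊆ Col(H¹_Iw(T))` from the RANK clause** (any base field / `ℤ_p`-extension / place; `p ∣ a_p`, a Honda system,
a `p`-torsion-free tower, `c_{−1} ∉ p·E(K_2·K_v)`): `forall_exists_isColemanPair_X_mul_of_independent` with (IND) supplied by
`honda_independent_of_rank`. [cite: Sprung2012, Thm. 2.2, Lemma 2.3 (p. 1487), Def. 5.9 (p. 1495), §7.1 (pp. 1500–1501)]
[cite: KuriharaPollack2007, Prop. 1.2] [cite: LeiSujatha2021, §3 (SES-KP)] -/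
theorem forall_exists_isColemanPair_X_mul_of_rank {ap : ℤ} (hap : (p : ℤ) ∣ ap) {g : Field.absoluteGaloisGroup E}
    (hg : κ.IsTopGenerator (resGalOfEmb ι g)) {cneg : localPoints W E} {c : ℕ → localPoints W E}
    (hH : IsHondaSystem κ ι W ap g cneg c)
    (hN : ∀ P : localPoints W E, P ∈ localTowerPointsOfEmb κ ι W → p • P = 0 → P = 0)
    (hcneg : ∀ (m : ℤ) (y : localPoints W E), y ∈ localLayerPointsOfEmb κ ι W 2 → p • y = m • cneg → (p : ℤ) ∣ m)
    (hrank : ∀ x : Fin (p ^ 2 - 1) → localPoints W E, (∀ i, x i ∈ localLayerPointsOfEmb κ ι W 2) →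
      ∃ w : localLayerPointsOfEmb κ ι W 2 →+ ℤ_[p],
        (∀ i, (p : ℤ_[p]) ∣ evalOn W (localLayerPointsOfEmb κ ι W 2) w (x i)) ∧
        ((∃ j : ℕ, ¬ (p : ℤ_[p]) ∣ evalOn W (localLayerPointsOfEmb κ ι W 2) w (g ^ j • c 2)) ∨
          ∃ j : ℕ, ¬ (p : ℤ_[p]) ∣ evalOn W (localLayerPointsOfEmb κ ι W 2) w (g ^ j • c 1))) :
    ∀ x y : IwasawaAlgebra p, ∃ z : localTowerPointsOfEmb κ ι W →+ ℤ_[p],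
      IsColemanPair κ ι W ap g c z (PowerSeries.X * x) (PowerSeries.X * y) :=
  forall_exists_isColemanPair_X_mul_of_independent hap hg hH hN (honda_independent_of_rank hap hg hH hN hcneg hrank)

end Local

/-! ## §3 Over `ℚ`: Lemma 2.3 and `c_{−1} ∉ p·E(ℚ_{p,2})` discharged — only the rank clause remains -/

section Rat

open NumberField IsDedekindDomain Literature.NumberTheory.EllipticCurves Literature.NumberTheory.GaloisRepresentations
  ZpExtension Literature.NumberTheory.EllipticCurves.Kobayashi2003 Literature.NumberTheory.EllipticCurves.Sprung2017

/-- `c_{−1} ∉ p·E(ℚ_{p,2})` over `ℚ` at an odd supersingular prime: there is a functional `z₀` on the tower with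
`p ∤ z₀(c_{−1})` (`exists_addMonoidHom_not_dvd_apply_cneg`, the heart of Prop. 7.3), so `p·y = m·c_{−1}` forces `p ∣ m`.
[cite: Sprung2012, proof of Prop. 7.3 (p. 1500), Thm. 2.2 and Lemma 2.3 (p. 1487)] -/
theorem natCast_dvd_of_nsmul_eq_zsmul_cneg (W : WeierstrassCurve ℚ) [W.IsElliptic] [W.IsGloballyMinimal]
    (p : ℕ) [Fact p.Prime] (hp2 : p ≠ 2) (hgood : W.HasGoodReductionAtPrime p) (hap : (p : ℤ) ∣ W.frobeniusTrace p)
    (κ : ZpExtension ℚ p) {v : HeightOneSpectrum (𝓞 ℚ)} (hpv : (p : 𝓞 ℚ) ∈ v.asIdeal) {ap : ℤ}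
    {g : Field.absoluteGaloisGroup (v.adicCompletion ℚ)} {cneg : localPoints W (v.adicCompletion ℚ)}
    {c : ℕ → localPoints W (v.adicCompletion ℚ)}
    (hH : IsHondaSystem κ (closureEmb (K := ℚ) (v.adicCompletion ℚ)) W ap g cneg c)
    (m : ℤ) (y : localPoints W (v.adicCompletion ℚ))
    (hy : y ∈ localLayerPointsOfEmb κ (closureEmb (K := ℚ) (v.adicCompletion ℚ)) W 2) (h : p • y = m • cneg) :
    (p : ℤ) ∣ m := by
  have hp : p.Prime := Fact.out
  obtain ⟨z₀, hz₀⟩ := exists_addMonoidHom_not_dvd_apply_cneg W p hp2 hgood hap κ hpv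
    (closureEmb (K := ℚ) (v.adicCompletion ℚ)) hH
  have hyT : y ∈ localTowerPointsOfEmb κ (closureEmb (K := ℚ) (v.adicCompletion ℚ)) W :=
    localLayerPointsOfEmb_le_localTowerPointsOfEmb κ _ W 2 hy
  have hcT := localLayerPointsOfEmb_le_localTowerPointsOfEmb κ (closureEmb (K := ℚ) (v.adicCompletion ℚ)) W 0 hH.1
  have e : (⟨p • y, AddSubgroup.nsmul_mem _ hyT p⟩ : localTowerPointsOfEmb κ _ W) = m • ⟨cneg, hcT⟩ :=
    Subtype.ext (by rw [AddSubgroupClass.coe_zsmul]; exact h)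
  have e' : (p : ℤ_[p]) * z₀ ⟨y, hyT⟩ = (m : ℤ_[p]) * z₀ ⟨cneg, hcT⟩ := by
    have h1 := congrArg z₀ e
    rw [map_zsmul, zsmul_eq_mul] at h1
    rw [← h1, ← nsmul_eq_mul, ← map_nsmul]
    rfl
  have hdvd : (p : ℤ_[p]) ∣ (m : ℤ_[p]) * z₀ ⟨cneg, hcT⟩ := ⟨_, e'.symm⟩
  rcases PadicInt.prime_p.dvd_or_dvd hdvd with hm | hc
  · exact (PadicInt.norm_int_lt_one_iff_dvd m).mp ((PadicInt.norm_lt_one_iff_dvd _).mpr hm)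
  · exact absurd hc hz₀

/-- **(SES-KP), cokernel half, over `ℚ`, from the RANK clause alone** — `W/ℚ` elliptic globally minimal, `p ≠ 2` good
supersingular, any `ℤ_p`-extension `κ`, `v ∋ p`, the chosen embedding, `g` a local lift of the topological generator,
`(c_{−1}, c)` a Honda system: IF no `p² − 1` points of `E(ℚ_{p,2})` contain the Honda orbit `{gʲc_2} ∪ {gʲc_1}` in their span
modulo `p` (witnessed by functionals `E(ℚ_{p,2}) →+ ℤ_p`; = «`Ê(ℚ_{p,2})` is `ℤ_p`-free of rank `p² = [ℚ_{p,2} : ℚ_p]`», Thm. 2.2 /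
Lemma 2.3 / Lutz), THEN every `(T·x, T·y)` is a Coleman value. With `IsColemanPair.eq_zero_of_pair_zero` and
`IsColemanPair.constantCoeff_eq`: `0 → H¹_Iw(T) → Λ² → ℤ_p → 0`.
[cite: Sprung2012, Thm. 2.2, Lemma 2.3 (p. 1487), Def. 5.9 (p. 1495), Def. 7.1–7.2, Props. 7.3/7.6 (pp. 1500–1501)]
[cite: KuriharaPollack2007, Prop. 1.2] [cite: LeiSujatha2021, §3 (SES-KP)] -/
theorem forall_exists_isColemanPair_X_mul_of_rank_rat (W : WeierstrassCurve ℚ) [W.IsElliptic] [W.IsGloballyMinimal]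
    (p : ℕ) [Fact p.Prime] (hp2 : p ≠ 2) (hgood : W.HasGoodReductionAtPrime p) (hap : (p : ℤ) ∣ W.frobeniusTrace p)
    (κ : ZpExtension ℚ p) {v : HeightOneSpectrum (𝓞 ℚ)} (hpv : (p : 𝓞 ℚ) ∈ v.asIdeal)
    {g : Field.absoluteGaloisGroup (v.adicCompletion ℚ)}
    (hg : κ.IsTopGenerator (resGalOfEmb (closureEmb (K := ℚ) (v.adicCompletion ℚ)) g))
    {cneg : localPoints W (v.adicCompletion ℚ)} {c : ℕ → localPoints W (v.adicCompletion ℚ)}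
    (hH : IsHondaSystem κ (closureEmb (K := ℚ) (v.adicCompletion ℚ)) W (W.frobeniusTrace p) g cneg c)
    (hrank : ∀ x : Fin (p ^ 2 - 1) → localPoints W (v.adicCompletion ℚ),
      (∀ i, x i ∈ localLayerPointsOfEmb κ (closureEmb (K := ℚ) (v.adicCompletion ℚ)) W 2) →
      ∃ w : localLayerPointsOfEmb κ (closureEmb (K := ℚ) (v.adicCompletion ℚ)) W 2 →+ ℤ_[p],
        (∀ i, (p : ℤ_[p]) ∣ evalOn W (localLayerPointsOfEmb κ (closureEmb (K := ℚ) (v.adicCompletion ℚ)) W 2) w (x i)) ∧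
        ((∃ j : ℕ, ¬ (p : ℤ_[p]) ∣
            evalOn W (localLayerPointsOfEmb κ (closureEmb (K := ℚ) (v.adicCompletion ℚ)) W 2) w (g ^ j • c 2)) ∨
          ∃ j : ℕ, ¬ (p : ℤ_[p]) ∣
            evalOn W (localLayerPointsOfEmb κ (closureEmb (K := ℚ) (v.adicCompletion ℚ)) W 2) w (g ^ j • c 1))) :
    ∀ x y : IwasawaAlgebra p, ∃ z : localTowerPointsOfEmb κ (closureEmb (K := ℚ) (v.adicCompletion ℚ)) W →+ ℤ_[p],
      IsColemanPair κ (closureEmb (K := ℚ) (v.adicCompletion ℚ)) W (W.frobeniusTrace p) g c z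
        (PowerSeries.X * x) (PowerSeries.X * y) :=
  forall_exists_isColemanPair_X_mul_of_rank hap hg hH
    (fun _ hP hpP ↦ eq_zero_of_mem_localTowerPointsOfEmb_of_prime_nsmul W p hp2 hgood hap κ hpv _ hP hpP)
    (natCast_dvd_of_nsmul_eq_zsmul_cneg W p hp2 hgood hap κ hpv hH) hrank

/-- **The joint Coleman map over `ℚ` with cokernel `Λ/(T)`, from the RANK clause** — the shape of the F-α skeleton's hypotheses
(`J`, `hJ`, `hcoker` of `min_lengthAt_quotient_range_le_lengthAt_torsion_of_skeleton`, `P = H¹_Iw(T)` the functional model with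
`moduleOfGenerator`): an INJECTIVE `Λ`-linear `J : H¹_Iw(T) → Λ × Λ` with `Col(z) = J z`, `T·Λ² ⊆ range J`, and
`ℓ_𝔭(Λ²/range J) = 0` at every prime `𝔭 ∌ T`. Residual hypothesis: the rank clause only (`Ê(ℚ_{p,2})` free of rank `p²`).
[cite: Sprung2012, Def. 5.9 (p. 1495), Def. 7.1–7.2, Props. 7.3/7.6 (pp. 1500–1501), Thm. 2.2 / Lemma 2.3 (p. 1487)]
[cite: KuriharaPollack2007, Prop. 1.2] [cite: LeiSujatha2021, §3 (SES-KP)] -/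
theorem exists_linearMap_isColemanPair_cokernel_of_rank_rat (W : WeierstrassCurve ℚ) [W.IsElliptic]
    [W.IsGloballyMinimal] (p : ℕ) [Fact p.Prime] (hp2 : p ≠ 2) (hgood : W.HasGoodReductionAtPrime p)
    (hap : (p : ℤ) ∣ W.frobeniusTrace p) (κ : ZpExtension ℚ p) {v : HeightOneSpectrum (𝓞 ℚ)} (hpv : (p : 𝓞 ℚ) ∈ v.asIdeal)
    {g : Field.absoluteGaloisGroup (v.adicCompletion ℚ)}
    (hg : κ.IsTopGenerator (resGalOfEmb (closureEmb (K := ℚ) (v.adicCompletion ℚ)) g))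
    {cneg : localPoints W (v.adicCompletion ℚ)} {c : ℕ → localPoints W (v.adicCompletion ℚ)}
    (hH : IsHondaSystem κ (closureEmb (K := ℚ) (v.adicCompletion ℚ)) W (W.frobeniusTrace p) g cneg c)
    (hrank : ∀ x : Fin (p ^ 2 - 1) → localPoints W (v.adicCompletion ℚ),
      (∀ i, x i ∈ localLayerPointsOfEmb κ (closureEmb (K := ℚ) (v.adicCompletion ℚ)) W 2) →
      ∃ w : localLayerPointsOfEmb κ (closureEmb (K := ℚ) (v.adicCompletion ℚ)) W 2 →+ ℤ_[p],
        (∀ i, (p : ℤ_[p]) ∣ evalOn W (localLayerPointsOfEmb κ (closureEmb (K := ℚ) (v.adicCompletion ℚ)) W 2) w (x i)) ∧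
        ((∃ j : ℕ, ¬ (p : ℤ_[p]) ∣
            evalOn W (localLayerPointsOfEmb κ (closureEmb (K := ℚ) (v.adicCompletion ℚ)) W 2) w (g ^ j • c 2)) ∨
          ∃ j : ℕ, ¬ (p : ℤ_[p]) ∣
            evalOn W (localLayerPointsOfEmb κ (closureEmb (K := ℚ) (v.adicCompletion ℚ)) W 2) w (g ^ j • c 1))) :
    letI := moduleOfGenerator κ (closureEmb (K := ℚ) (v.adicCompletion ℚ)) W hg
    ∃ J : (localTowerPointsOfEmb κ (closureEmb (K := ℚ) (v.adicCompletion ℚ)) W →+ ℤ_[p]) →ₗ[IwasawaAlgebra p]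
        IwasawaAlgebra p × IwasawaAlgebra p,
      (∀ z, IsColemanPair κ (closureEmb (K := ℚ) (v.adicCompletion ℚ)) W (W.frobeniusTrace p) g c z (J z).1 (J z).2) ∧
      Function.Injective J ∧
      (∀ x y : IwasawaAlgebra p, ∃ z, J z = (PowerSeries.X * x, PowerSeries.X * y)) ∧
      ∀ 𝔭 : PrimeSpectrum (IwasawaAlgebra p), (PowerSeries.X : IwasawaAlgebra p) ∉ 𝔭.asIdeal →
        Module.lengthAt (IwasawaAlgebra p) ((IwasawaAlgebra p × IwasawaAlgebra p) ⧸ LinearMap.range J) 𝔭 = 0 :=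
  exists_linearMap_isColemanPair_cokernel_rat W p hp2 hgood hap κ hpv hg hH
    (honda_independent_of_rank hap hg hH
      (fun _ hP hpP ↦ eq_zero_of_mem_localTowerPointsOfEmb_of_prime_nsmul W p hp2 hgood hap κ hpv _ hP hpP)
      (natCast_dvd_of_nsmul_eq_zsmul_cneg W p hp2 hgood hap κ hpv hH) hrank)

end Rat

end Literature.NumberTheory.EllipticCurves.Sprung2012

end
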